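import Mathlib
import HarnessLib

/-!
# Markman 2025 — TRANSPORT of the hypothesis «ker ob_E = ann ch(E)» under a derived equivalence and the
# KERNEL SQUEEZE for the ideal sheaf of `n` translated genus-3 curves ([M] Remark 8.3.6, Lemma 8.3.10,
# Corollary 8.3.12), AS PRINTED: the linear-algebra skeleton, kernel-checked

E. Markman: [M] *Cycles on abelian 2n-folds of Weil type from secant sheaves on abelian n-folds*,
arXiv:2502.03415 **v2** (2025-06-08), bib `Markman2025SecantWeil` — UNREFEREED PREPRINT. Pages/lines = PyMuPDF lines
of the public v2 PDF (sha256/16 `8155aa33870069b8`), read at seat lit-w-markman g14 (pub-hsemireg LIT-W,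
2026-08-23; sheet `LOCATOR-SHEET-MARKMAN.md` §41). Companion of `SpinorSecantDimensionCounts.lean` (the NUMBERS of
Lemma 8.3.3 / Prop. 8.3.9: `dim HT²(X) = 3 + 9 + 3 = 15`, `rank(ob_F) = 6`, `dim ker(ob_F) = 9`) and of
`Literature/AlgebraicGeometry/HodgeTheory/SemiregularityWeakCriterion.lean` (Lemma 8.3.4 / Remark 8.3.5: the squeeze
«kernels equal (+ `ob_E` onto) ⇒ `σ_E` injective (on `im ob_E`)»). This file adds the three printed steps that carry the
hypothesis «the kernel of `ob` equals the annihilator of `ch`» from one object to another, and that ESTABLISH it for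
Markman's `F = I_{∪ C_i}(Θ)`.

## What is printed (verbatim, v2)
* REMARK 8.3.6 (p. 59 L40–52): «Note that the hypotheses of Lemma 8.3.4 are invariant under derived equivalences. If
  `Φ : D^b(M) → D^b(M′)` is an equivalence of derived categories, `E` satisfies the hypotheses of Lemma 8.3.4, and
  `Φ(E)` is represented by a coherent sheaf `E′`, then `E′` satisfies the hypotheses of Lemma 8.3.4 and is thus
  semiregular as well. The space `∏_{q=0}^{d−2} H^{q+2}(M, Ω^q_M)` in the above diagrams is the graded summand
  `HΩ_{−2}(M)` of the Hochschild homology `HH_*(M)`. The equivalence `Φ` induces isomorphisms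
  `Φ : Ext²(E, E) → Ext²(E′, E′)` and `Φ_* : HΩ_{−2}(M) → HΩ_{−2}(M′)`. The hypotheses of Lemma 8.3.4 imply that the
  semiregularity map `σ′` of `E′` is the conjugate of the semiregularity map `σ` of `E`, `σ′ ∘ Φ = Φ_* ∘ σ`. It is
  natural to expect that the latter equality holds, more generally, without the hypotheses of Lemma 8.3.4.»
* LEMMA 8.3.10 (p. 62 L96–99): «Let `Φ : D^b(A) → D^b(B)` be an equivalence of derived categories of two abelian
  varieties and `F` an object of `D^b(A)`. Assume that the kernel of `ob_F : HT²(A) → Hom(F, F[2])` is equal to the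
  subspace annihilating `ch(F)`. Then the kernel of `ob_{Φ(F)}` is equal to the subspace annihilating `ch(Φ(F))`.»
  Proof (p. 62 L100 – p. 63 L5): «We have the commutative diagram [rows `H^*(A, ℂ) ←^{ch(F)} HT²(A) →^{exp(at_F)}
  Hom(F, F[2])` over `H^*(B, ℂ) ←^{ch(E)} HT²(B) →^{exp(at_E)} Hom(E, E[2])`, vertical arrows `Φ^H`, `Φ^{HT}`, `Φ`],
  the left square by [CBR], and the right square by [Hua, Theorem A]. The vertical arrows are isomorphisms and the
  kernels of the two horizontal arrows in the top row are equal. Hence, the same is true for the bottom row.»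
* COROLLARY 8.3.12 (p. 63 L17–43): «Set `F := I_{∪_{i=1}^n C_i}(Θ)`. The kernel of `ob_F` is equal to the kernel of
  the homomorphism `(•)⌟ch(F) : HT²(X) → H^*(X, ℂ)` of contraction with the Chern character of `F`. Proof. It suffices
  to prove the statement for `F′ := I_{∪_{i=1}^n C_i}`, by Lemma 8.3.10, as `F` is the image of `F′` by the
  autoequivalence of tensorization by `Θ`. Now, `ch(I_{∪ C_i}) = 1 − (n/2)Θ² + 2n[pt]`. The kernel of `ob_{F′}` is
  contained in the kernel `K` of `⌟ch(F′)`, by [Hua, Theorem B]. The kernel of `ob_{F′}` is 9 dimensional, by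
  Proposition 8.3.9. It suffices to show that `dim(K) ≤ 9`. Assume that `dim(K) > 9`. Then the intersection
  `K ∩ [H²(𝒪_X) ⊕ H⁰(∧²TX)]` would be non-trivial. We claim that `K ∩ [H²(𝒪_X) ⊕ H⁰(∧²TX)] = (0)`. Indeed,
  contraction with `ch(F′)` induces the homomorphism `H²(𝒪_X) ⊕ H⁰(∧²TX) → H²(𝒪_X) ⊕ H³(Ω¹_X)` with upper
  triangular matrix `[[1, −(n/2)Θ²], [0, 2n[pt]]]`, which is invertible □» (matrix printed as two rows `1 −(n/2)Θ²` ∕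
  `0 2n[pt]`; here `X = Pic²(C)`, `C` of genus 3, the `C_i` disjoint translates of `C`, §8.3 pp. 56–57;
  `HT²(X) := H²(𝒪_X) ⊕ H¹(TX) ⊕ H⁰(∧²TX)`, p. 58 L43). The three windows were read BY EYE on 160-dpi renders
  (`HOME/lit/Markman-renders-litw-markman-g14/r_mar25_v2_p59_L834_R836.png`, `…p62_L8310.png`, `…p63_top_C8312.png`);
  the text layer prints the product sign `∏` of Remark 8.3.6 as «Q» and flattens the matrix.

## Dictionary and what this file proves (linear algebra over a field; theorems only; NO named fact, NO sorry)
`T, T′` = `HT²` of the two varieties; `E, E′` = `Ext²` (`Hom(F, F[2])`); `H, H′` = `H^*(·, ℂ)` (or `HΩ_{−2}`);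
`ob, ob′` the obstruction maps; `c, c′` contraction with `ch`; `σ, σ′` the semiregularity maps with the commutative
triangles `σ ∘ ob = c` ((8.3.4), [BF2]); `φ = Φ^{HT}`, `ψ = Φ`, `χ = Φ^H / Φ_*` the three ISOMORPHISMS induced by the
derived equivalence, with the two commuting squares `ob′ ∘ φ = ψ ∘ ob` ([Hua, Thm A]) and `c′ ∘ φ = χ ∘ c` ([CBR]).
One `χ` serves both printed targets — `Φ^H` on `H^*(·, ℂ)` (Lemma 8.3.10's [CBR] square) and `Φ_*` on «the graded summand
`HΩ_{−2}`» (diagram (8.3.4) / Remark 8.3.6); as linear algebra this is harmless (the image of `⌟ch(E)` on `HT²` lies in that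
summand), and a reader may split it (pre-filing statement read ×2 across seats: lit-3 g39, CONCUR, pin P1).
* `kerEq_transport` (LEMMA 8.3.10, and the first sentence of REMARK 8.3.6): `ker ob = ker c ↔ ker ob′ = ker c′`;
  `surjective_transport`: `ob` onto `↔` `ob′` onto — so BOTH hypotheses of Lemma 8.3.4 transfer.
* `sigma_conj_on_range` / `sigma_conj` (REMARK 8.3.6, second half): with the two triangles and the two squares,
  `σ′ (ψ e) = χ (σ e)` for every `e ∈ im(ob)` — hence `σ′ ∘ ψ = χ ∘ σ` when `ob` is onto (the printed «the hypotheses of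
  Lemma 8.3.4 imply …»); off `im(ob)` nothing is asserted (the printed «natural to expect» is NOT proved here or there).
* `blockTriangular_injective` (COR. 8.3.12, «upper triangular matrix … which is invertible» ⇒ `K ∩ [A ⊕ C] = (0)`,
  used in `ker_ob_eq_ker_contract_of_blockTriangular`): a map `A ⊕ C → A′ ⊕ C′` of shape
  `(a, z) ↦ (α a + β z, γ z)` with `α`, `γ` injective is injective;
* `eq_of_le_of_disjoint_of_finrank` (COR. 8.3.12, «It suffices to show that dim(K) ≤ 9. Assume that dim(K) > 9. Then
  the intersection … would be non-trivial»): in a finite-dimensional `V`, `K₀ ≤ K`, `K ∩ W = 0` and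
  `dim V ≤ dim K₀ + dim W` force `K₀ = K`;
* `ker_ob_eq_ker_contract` (COR. 8.3.12 assembled on `V = A ⊕ B ⊕ C`): `ker ob ≤ ker c` ([Hua, Thm B]), `rank ob =
  dim A + dim C` (Prop. 8.3.9's `6 = 3 + 3` with Lemma 8.3.2), and `c` injective on `A ⊕ C` (the triangular block) give
  `ker ob = ker c`, and then `dim ker c = dim B` (`= dim H¹(T_X) = 9`, `ker_contract_finrank`);
* `cor8312_numbers`: the printed numbers at genus 3 with `n ≥ 1` curves — the diagonal entries `1` and `2n` of the
  triangular matrix are non-zero, `3 + 9 + 3 = 15`, `6 = 3 + 3`, `15 − 6 = 9`.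

## Inputs BY VALUE (NOT proved here) and honest framing
The commuting squares ([CBR], [Hua, Thm A]), the inclusion `ker ob ⊆ ker ⌟ch` ([Hua, Thm B]), `rank(ob_F) = 6`
(Prop. 8.3.9), the Hodge numbers `3, 9, 3, 3`, and the invertibility of `[pt]⌟ : H⁰(∧²T_X) → H³(Ω¹_X)` are inputs,
entered as hypotheses of the theorems below; the kernel adds only the linear algebra that the three printed proofs
consist of. Nothing here says that any sheaf is semiregular, and nothing here bears on HC / HC_CM / HC_AV.
-/

namespace Literature.AlgebraicGeometry.Markman2025

namespace ObstructionKernel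

section Transport

variable {K : Type*} [Field K]
variable {T T' E E' H H' : Type*} [AddCommGroup T] [Module K T] [AddCommGroup T'] [Module K T']
  [AddCommGroup E] [Module K E] [AddCommGroup E'] [Module K E'] [AddCommGroup H] [Module K H]
  [AddCommGroup H'] [Module K H']

/-- A commuting square `f′ ∘ φ = ψ ∘ f` with `φ`, `ψ` isomorphisms pulls `ker f′` back to `ker f`:
`φ⁻¹(ker f′) = ker f`. (The one-line mechanism of [M] Lemma 8.3.10's proof: «The vertical arrows are
isomorphisms …».) [cite: Markman2025SecantWeil, Lemma 8.3.10, proof (v2 p. 62 L100 – p. 63 L5)] -/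
theorem comap_ker_eq_of_square (f : T →ₗ[K] E) (f' : T' →ₗ[K] E') (φ : T ≃ₗ[K] T') (ψ : E ≃ₗ[K] E')
    (hsq : f' ∘ₗ (φ : T →ₗ[K] T') = (ψ : E →ₗ[K] E') ∘ₗ f) :
    (LinearMap.ker f').comap (φ : T →ₗ[K] T') = LinearMap.ker f := by
  rw [← LinearMap.ker_comp, hsq, LinearMap.ker_comp, LinearEquiv.ker, Submodule.comap_bot]

/-- **[M] LEMMA 8.3.10 (v2 p. 62 L96–99), the linear algebra of its proof (p. 62 L100 – p. 63 L5), which is also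
the first sentence of REMARK 8.3.6 (p. 59 L40–44) for the kernel hypothesis of Lemma 8.3.4.** Two rows
`H ←^{c} T →^{ob} E` and `H′ ←^{c′} T′ →^{ob′} E′` joined by ISOMORPHISMS `χ, φ, ψ` with commuting squares
`ob′ ∘ φ = ψ ∘ ob` («the right square by [Hua, Theorem A]») and `c′ ∘ φ = χ ∘ c` («the left square by [CBR]»):
«the kernels of the two horizontal arrows in the top row are equal» if and only if «the same is true for the bottom
row». The squares and the isomorphisms are hypotheses (inputs by value).
[cite: Markman2025SecantWeil, Lemma 8.3.10 (v2 p. 62 L96 – p. 63 L5) and Remark 8.3.6 (p. 59 L40–44)] -/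
theorem kerEq_transport (ob : T →ₗ[K] E) (c : T →ₗ[K] H) (ob' : T' →ₗ[K] E') (c' : T' →ₗ[K] H')
    (φ : T ≃ₗ[K] T') (ψ : E ≃ₗ[K] E') (χ : H ≃ₗ[K] H')
    (hob : ob' ∘ₗ (φ : T →ₗ[K] T') = (ψ : E →ₗ[K] E') ∘ₗ ob)
    (hc : c' ∘ₗ (φ : T →ₗ[K] T') = (χ : H →ₗ[K] H') ∘ₗ c) :
    LinearMap.ker ob = LinearMap.ker c ↔ LinearMap.ker ob' = LinearMap.ker c' := by
  have h1 := comap_ker_eq_of_square ob ob' φ ψ hob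
  have h2 := comap_ker_eq_of_square c c' φ χ hc
  constructor
  · intro h
    have h3 : (LinearMap.ker ob').comap (φ : T →ₗ[K] T') = (LinearMap.ker c').comap (φ : T →ₗ[K] T') := by
      rw [h1, h2, h]
    exact Submodule.comap_injective_of_surjective φ.surjective h3
  · intro h
    rw [← h1, ← h2, h]

/-- **[M] REMARK 8.3.6, first sentence (v2 p. 59 L40–44), the SURJECTIVITY hypothesis of Lemma 8.3.4**: across a
commuting square `ob′ ∘ φ = ψ ∘ ob` with `φ`, `ψ` isomorphisms, `ob` is onto if and only if `ob′` is onto. Together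
with `kerEq_transport` this is «the hypotheses of Lemma 8.3.4 are invariant under derived equivalences» — for the two
linear-algebra hypotheses; that `Φ(E)` «is represented by a coherent sheaf `E′`» is a separate, geometric proviso of
the remark, not modelled here. [cite: Markman2025SecantWeil, Remark 8.3.6 (v2 p. 59 L40–44)] -/
theorem surjective_transport (ob : T →ₗ[K] E) (ob' : T' →ₗ[K] E') (φ : T ≃ₗ[K] T') (ψ : E ≃ₗ[K] E')
    (hob : ob' ∘ₗ (φ : T →ₗ[K] T') = (ψ : E →ₗ[K] E') ∘ₗ ob) :
    Function.Surjective ob ↔ Function.Surjective ob' := by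
  have hpt : ∀ x : T, ob' (φ x) = ψ (ob x) := fun x => by
    simpa using LinearMap.congr_fun hob x
  constructor
  · intro h y'
    obtain ⟨x, hx⟩ := h (ψ.symm y')
    exact ⟨φ x, by rw [hpt, hx, LinearEquiv.apply_symm_apply]⟩
  · intro h y
    obtain ⟨x', hx'⟩ := h (ψ y)
    refine ⟨φ.symm x', ψ.injective ?_⟩
    rw [← hpt, LinearEquiv.apply_symm_apply, hx']

/-- **[M] REMARK 8.3.6, second half (v2 p. 59 L45–51), ON THE IMAGE OF `ob`**: with the two commutative triangles
`σ ∘ ob = c`, `σ′ ∘ ob′ = c′` (diagram (8.3.4) for `E` and for `E′`) and the two commuting squares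
`ob′ ∘ φ = ψ ∘ ob`, `c′ ∘ φ = χ ∘ c`, the semiregularity maps are conjugate ON `im(ob)`:
`σ′(ψ(ob x)) = χ(σ(ob x))` for every `x` — no surjectivity and no kernel hypothesis is needed for this much.
[cite: Markman2025SecantWeil, Remark 8.3.6 (v2 p. 59 L45–51)] -/
theorem sigma_conj_on_range (ob : T →ₗ[K] E) (σ : E →ₗ[K] H) (c : T →ₗ[K] H)
    (ob' : T' →ₗ[K] E') (σ' : E' →ₗ[K] H') (c' : T' →ₗ[K] H')
    (φ : T ≃ₗ[K] T') (ψ : E ≃ₗ[K] E') (χ : H ≃ₗ[K] H')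
    (hcomm : σ ∘ₗ ob = c) (hcomm' : σ' ∘ₗ ob' = c')
    (hob : ob' ∘ₗ (φ : T →ₗ[K] T') = (ψ : E →ₗ[K] E') ∘ₗ ob)
    (hc : c' ∘ₗ (φ : T →ₗ[K] T') = (χ : H →ₗ[K] H') ∘ₗ c) (x : T) :
    σ' (ψ (ob x)) = χ (σ (ob x)) := by
  have h1 : ob' (φ x) = ψ (ob x) := by simpa using LinearMap.congr_fun hob x
  have h2 : c' (φ x) = χ (c x) := by simpa using LinearMap.congr_fun hc x
  have h3 : σ (ob x) = c x := by simpa using LinearMap.congr_fun hcomm x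
  have h4 : σ' (ob' (φ x)) = c' (φ x) := by simpa using LinearMap.congr_fun hcomm' (φ x)
  rw [← h1, h4, h2, h3]

/-- **[M] REMARK 8.3.6, second half (v2 p. 59 L49–51)**: «The hypotheses of Lemma 8.3.4 imply that the
semiregularity map `σ′` of `E′` is the conjugate of the semiregularity map `σ` of `E`, `σ′ ∘ Φ = Φ_* ∘ σ`.» — here
from the SURJECTIVITY of `ob` alone (the kernel hypothesis of Lemma 8.3.4 is not used for the conjugation; it is what
`kerEq_transport` carries across). The printed continuation «It is natural to expect that the latter equality holds,
more generally, without the hypotheses of Lemma 8.3.4» is an expectation, NOT proved in [M] and not asserted here.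
[cite: Markman2025SecantWeil, Remark 8.3.6 (v2 p. 59 L45–52)] -/
theorem sigma_conj (ob : T →ₗ[K] E) (σ : E →ₗ[K] H) (c : T →ₗ[K] H)
    (ob' : T' →ₗ[K] E') (σ' : E' →ₗ[K] H') (c' : T' →ₗ[K] H')
    (φ : T ≃ₗ[K] T') (ψ : E ≃ₗ[K] E') (χ : H ≃ₗ[K] H')
    (hcomm : σ ∘ₗ ob = c) (hcomm' : σ' ∘ₗ ob' = c')
    (hob : ob' ∘ₗ (φ : T →ₗ[K] T') = (ψ : E →ₗ[K] E') ∘ₗ ob)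
    (hc : c' ∘ₗ (φ : T →ₗ[K] T') = (χ : H →ₗ[K] H') ∘ₗ c)
    (hsurj : Function.Surjective ob) :
    σ' ∘ₗ (ψ : E →ₗ[K] E') = (χ : H →ₗ[K] H') ∘ₗ σ := by
  apply LinearMap.ext
  intro e
  obtain ⟨x, rfl⟩ := hsurj e
  simpa using sigma_conj_on_range ob σ c ob' σ' c' φ ψ χ hcomm hcomm' hob hc x

/-- REMARK 8.3.6 assembled (v2 p. 59 L40–51): if `E` satisfies BOTH hypotheses of Lemma 8.3.4 (`ker ob = ker c` and
`ob` onto), then so does `E′` across the derived equivalence, and the semiregularity maps are conjugate; with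
`SemiregularityWeakCriterion.semiregular_of_ker_eq_of_surjective` (Lemma 8.3.4) `E′` «is thus semiregular as well».
[cite: Markman2025SecantWeil, Remark 8.3.6 (v2 p. 59 L40–51)] -/
theorem remark836 (ob : T →ₗ[K] E) (σ : E →ₗ[K] H) (c : T →ₗ[K] H)
    (ob' : T' →ₗ[K] E') (σ' : E' →ₗ[K] H') (c' : T' →ₗ[K] H')
    (φ : T ≃ₗ[K] T') (ψ : E ≃ₗ[K] E') (χ : H ≃ₗ[K] H')
    (hcomm : σ ∘ₗ ob = c) (hcomm' : σ' ∘ₗ ob' = c')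
    (hob : ob' ∘ₗ (φ : T →ₗ[K] T') = (ψ : E →ₗ[K] E') ∘ₗ ob)
    (hc : c' ∘ₗ (φ : T →ₗ[K] T') = (χ : H →ₗ[K] H') ∘ₗ c)
    (hker : LinearMap.ker ob = LinearMap.ker c) (hsurj : Function.Surjective ob) :
    LinearMap.ker ob' = LinearMap.ker c' ∧ Function.Surjective ob' ∧
      σ' ∘ₗ (ψ : E →ₗ[K] E') = (χ : H →ₗ[K] H') ∘ₗ σ :=
  ⟨(kerEq_transport ob c ob' c' φ ψ χ hob hc).mp hker, (surjective_transport ob ob' φ ψ hob).mp hsurj,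
    sigma_conj ob σ c ob' σ' c' φ ψ χ hcomm hcomm' hob hc hsurj⟩

end Transport

section Squeeze

variable {K : Type*} [Field K]

/-- The value of the block-triangular map: `(a, z) ↦ (α a + β z, γ z)`. [folklore] -/
private theorem blockTriangular_apply {A C A' C' : Type*} [AddCommGroup A] [Module K A] [AddCommGroup C]
    [Module K C] [AddCommGroup A'] [Module K A'] [AddCommGroup C'] [Module K C']
    (α : A →ₗ[K] A') (β : C →ₗ[K] A') (γ : C →ₗ[K] C') (a : A) (z : C) :
    ((α.coprod β).prod (γ ∘ₗ LinearMap.snd K A C)) (a, z) = (α a + β z, γ z) := by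
  simp

/-- **[M] COR. 8.3.12, the matrix step (v2 p. 63 L31–42)**: «contraction with `ch(F′)` induces the homomorphism
`H²(𝒪_X) ⊕ H⁰(∧²T_X) → H²(𝒪_X) ⊕ H³(Ω¹_X)` with upper triangular matrix `[[1, −(n/2)Θ²], [0, 2n[pt]]]`, which is
invertible». Abstractly: a map `A ⊕ C → A′ ⊕ C′`, `(a, z) ↦ (α a + β z, γ z)`, whose diagonal blocks `α`, `γ` are
injective is injective (here `α = ·⌟1 = id`, `γ = ·⌟2n[pt]`, `β = ·⌟(−(n/2)Θ²)`; invertibility of the diagonal blocks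
is an input by value). [cite: Markman2025SecantWeil, Corollary 8.3.12, proof (v2 p. 63 L31–42)] -/
theorem blockTriangular_injective {A C A' C' : Type*} [AddCommGroup A] [Module K A] [AddCommGroup C] [Module K C]
    [AddCommGroup A'] [Module K A'] [AddCommGroup C'] [Module K C']
    (α : A →ₗ[K] A') (β : C →ₗ[K] A') (γ : C →ₗ[K] C')
    (hα : Function.Injective α) (hγ : Function.Injective γ) :
    Function.Injective ((α.coprod β).prod (γ ∘ₗ LinearMap.snd K A C)) := by
  intro p q hpq
  obtain ⟨a, z⟩ := p
  obtain ⟨a', z'⟩ := q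
  rw [blockTriangular_apply, blockTriangular_apply, Prod.mk.injEq] at hpq
  obtain ⟨h1, h2⟩ := hpq
  have hz : z = z' := hγ h2
  subst hz
  have ha : α a = α a' := add_right_cancel h1
  rw [hα ha]

/-- **[M] COR. 8.3.12, the dimension step (v2 p. 63 L28–30)**: «It suffices to show that `dim(K) ≤ 9`. Assume that
`dim(K) > 9`. Then the intersection `K ∩ [H²(𝒪_X) ⊕ H⁰(∧²T_X)]` would be non-trivial.» Abstractly, in a
finite-dimensional `V`: if `K₀ ≤ K`, `K ∩ W = 0`, and `dim V ≤ dim K₀ + dim W`, then `K₀ = K` (there `K₀ = ker ob_{F′}`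
of dimension 9, `K` the kernel of `⌟ch(F′)`, `W = H²(𝒪_X) ⊕ H⁰(∧²T_X)` of dimension 6, `dim V = 15`).
[cite: Markman2025SecantWeil, Corollary 8.3.12, proof (v2 p. 63 L27–30)] -/
theorem eq_of_le_of_disjoint_of_finrank {V : Type*} [AddCommGroup V] [Module K V] [FiniteDimensional K V]
    {K₀ Kc W : Submodule K V} (hle : K₀ ≤ Kc) (hdisj : Disjoint Kc W)
    (hdim : Module.finrank K V ≤ Module.finrank K K₀ + Module.finrank K W) : K₀ = Kc := by
  apply Submodule.eq_of_le_of_finrank_le hle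
  have h1 := Submodule.finrank_sup_add_finrank_inf_eq Kc W
  rw [hdisj.eq_bot, finrank_bot, add_zero] at h1
  have h2 : Module.finrank K ↥(Kc ⊔ W) ≤ Module.finrank K V := Submodule.finrank_le _
  omega

variable {A B C W E : Type*} [AddCommGroup A] [Module K A] [AddCommGroup B] [Module K B]
  [AddCommGroup C] [Module K C] [AddCommGroup W] [Module K W] [AddCommGroup E] [Module K E]

/-- The coordinate inclusion `A ⊕ C ↪ A ⊕ B ⊕ C`, `(a, z) ↦ (a, 0, z)` (the summand `H²(𝒪_X) ⊕ H⁰(∧²T_X)` of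
`HT²(X) = H²(𝒪_X) ⊕ H¹(T_X) ⊕ H⁰(∧²T_X)`, [M] p. 58 L43 / p. 63 L29–30). [folklore] -/
private theorem inAC_apply (a : A) (z : C) :
    ((LinearMap.inl K A (B × C)).coprod (LinearMap.inr K A (B × C) ∘ₗ LinearMap.inr K B C)) (a, z) =
      (a, 0, z) := by
  simp

/-- The coordinate inclusion `(a, z) ↦ (a, 0, z)` is injective. [folklore] -/
private theorem inAC_injective :
    Function.Injective
      ((LinearMap.inl K A (B × C)).coprod (LinearMap.inr K A (B × C) ∘ₗ LinearMap.inr K B C)) := by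
  intro p q hpq
  obtain ⟨a, z⟩ := p
  obtain ⟨a', z'⟩ := q
  rw [inAC_apply, inAC_apply] at hpq
  simp only [Prod.mk.injEq] at hpq
  exact Prod.ext hpq.1 hpq.2.2

/-- **[M] COROLLARY 8.3.12 (v2 p. 63 L17–43), the whole proof as linear algebra on
`V = A ⊕ B ⊕ C` (`= H²(𝒪_X) ⊕ H¹(T_X) ⊕ H⁰(∧²T_X)`).** Hypotheses, each an input named in the printed proof:
`hHua` — «The kernel of `ob_{F′}` is contained in the kernel `K` of `⌟ch(F′)`, by [Hua, Theorem B]»;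
`hrank` — `rank(ob_{F′}) = dim A + dim C` («The kernel of `ob_{F′}` is 9 dimensional, by Proposition 8.3.9», i.e.
rank `6 = 15 − 9 = 3 + 3`); `hinj` — `⌟ch(F′)` kills no non-zero vector of `A ⊕ C` («`K ∩ [H²(𝒪_X) ⊕ H⁰(∧²T_X)] =
(0)`», from the invertible triangular matrix — see `ker_ob_eq_ker_contract_of_blockTriangular` for that form).
Conclusion: «The kernel of `ob_F` is equal to the kernel of the homomorphism `(•)⌟ch(F)`». The target `W` of the
contraction is arbitrary (print: `H^*(X, ℂ)`). [cite: Markman2025SecantWeil, Corollary 8.3.12 (v2 p. 63 L17–43)] -/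
theorem ker_ob_eq_ker_contract [FiniteDimensional K A] [FiniteDimensional K B] [FiniteDimensional K C]
    (c : (A × B × C) →ₗ[K] W) (ob : (A × B × C) →ₗ[K] E)
    (hHua : LinearMap.ker ob ≤ LinearMap.ker c)
    (hrank : Module.finrank K (LinearMap.range ob) = Module.finrank K A + Module.finrank K C)
    (hinj : ∀ (a : A) (z : C), c (a, 0, z) = 0 → a = 0 ∧ z = 0) :
    LinearMap.ker ob = LinearMap.ker c := by
  -- `W₀ := A ⊕ 0 ⊕ C` as the range of the coordinate inclusion
  set ι : (A × C) →ₗ[K] (A × B × C) :=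
    (LinearMap.inl K A (B × C)).coprod (LinearMap.inr K A (B × C) ∘ₗ LinearMap.inr K B C) with hι
  have hιinj : Function.Injective ι := inAC_injective
  -- `K ∩ W₀ = 0`
  have hdisj : Disjoint (LinearMap.ker c) (LinearMap.range ι) := by
    rw [Submodule.disjoint_def]
    intro v hv hv'
    obtain ⟨⟨a, z⟩, rfl⟩ := LinearMap.mem_range.mp hv'
    have hv0 : c (a, 0, z) = 0 := by
      have := LinearMap.mem_ker.mp hv
      rwa [hι, inAC_apply] at this
    obtain ⟨ha, hz⟩ := hinj a z hv0
    subst ha; subst hz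
    simp [hι]
  -- dimension count: `dim V = rank ob + dim ker ob = (dim A + dim C) + dim ker ob = dim W₀ + dim ker ob`
  have hW : Module.finrank K (LinearMap.range ι) = Module.finrank K A + Module.finrank K C := by
    rw [LinearMap.finrank_range_of_inj hιinj, Module.finrank_prod]
  have hV : Module.finrank K (A × B × C) =
      Module.finrank K (LinearMap.range ob) + Module.finrank K (LinearMap.ker ob) :=
    (LinearMap.finrank_range_add_finrank_ker ob).symm
  exact eq_of_le_of_disjoint_of_finrank hHua hdisj (by omega)

/-- COR. 8.3.12 with the hypothesis `K ∩ [A ⊕ C] = (0)` supplied, as in print, by the TRIANGULAR MATRIX: if, after a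
linear projection `π` of the target onto `A′ ⊕ C′` (`= H²(𝒪_X) ⊕ H³(Ω¹_X)`), the contraction restricted to `A ⊕ C`
reads `(a, z) ↦ (α a + β z, γ z)` with `α` (`= ⌟ch₀ = ⌟1`) and `γ` (`= ⌟2n[pt]`) injective, then `ker ob = ker ⌟ch`.
[cite: Markman2025SecantWeil, Corollary 8.3.12, proof (v2 p. 63 L21–43)] -/
theorem ker_ob_eq_ker_contract_of_blockTriangular [FiniteDimensional K A] [FiniteDimensional K B]
    [FiniteDimensional K C] {A' C' : Type*} [AddCommGroup A'] [Module K A'] [AddCommGroup C'] [Module K C']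
    (c : (A × B × C) →ₗ[K] W) (ob : (A × B × C) →ₗ[K] E) (π : W →ₗ[K] (A' × C'))
    (α : A →ₗ[K] A') (β : C →ₗ[K] A') (γ : C →ₗ[K] C')
    (hblock : ∀ (a : A) (z : C), π (c (a, 0, z)) = (α a + β z, γ z))
    (hα : Function.Injective α) (hγ : Function.Injective γ)
    (hHua : LinearMap.ker ob ≤ LinearMap.ker c)
    (hrank : Module.finrank K (LinearMap.range ob) = Module.finrank K A + Module.finrank K C) :
    LinearMap.ker ob = LinearMap.ker c := by
  refine ker_ob_eq_ker_contract c ob hHua hrank ?_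
  intro a z h0
  have h1 : ((α.coprod β).prod (γ ∘ₗ LinearMap.snd K A C)) (a, z) = 0 := by
    rw [blockTriangular_apply, ← hblock, h0, map_zero]
  have h2 := blockTriangular_injective α β γ hα hγ (h1.trans (map_zero _).symm)
  exact Prod.mk_eq_zero.mp h2

/-- COR. 8.3.12, the dimension of the common kernel: under the same hypotheses `dim ker(⌟ch(F′)) = dim B`
(`= dim H¹(T_X) = 9` at genus 3: the «9 dimensional» kernel is forced onto the dimension of the middle summand,
though print does not say it IS `H¹(T_X)` and neither does this theorem).
[cite: Markman2025SecantWeil, Corollary 8.3.12, proof (v2 p. 63 L27–30)] -/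
theorem ker_contract_finrank [FiniteDimensional K A] [FiniteDimensional K B] [FiniteDimensional K C]
    (c : (A × B × C) →ₗ[K] W) (ob : (A × B × C) →ₗ[K] E)
    (hHua : LinearMap.ker ob ≤ LinearMap.ker c)
    (hrank : Module.finrank K (LinearMap.range ob) = Module.finrank K A + Module.finrank K C)
    (hinj : ∀ (a : A) (z : C), c (a, 0, z) = 0 → a = 0 ∧ z = 0) :
    Module.finrank K (LinearMap.ker c) = Module.finrank K B := by
  rw [← ker_ob_eq_ker_contract c ob hHua hrank hinj]
  have hV := LinearMap.finrank_range_add_finrank_ker ob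
  rw [Module.finrank_prod, Module.finrank_prod, hrank] at hV
  omega

/-- **[M] COR. 8.3.12 — the printed NUMBERS (genus 3, `n ≥ 1` translated curves `C_i`, v2 p. 63 L24–42 with
p. 58 L43–56 and Prop. 8.3.9 p. 61).** `ch(I_{∪ C_i}) = 1 − (n/2)Θ² + 2n[pt]`: the diagonal entries `1` and `2n`
of the triangular matrix are non-zero for `n ≥ 1` (so its diagonal blocks `⌟1 = id_{H²(𝒪_X)}` and `⌟2n[pt]` are
invertible once `[pt]⌟ : H⁰(∧²T_X) → H³(Ω¹_X)` is — an input), and the off-diagonal coefficient is `−n/2`; the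
dimensions: `dim HT²(X) = h^{0,2} + h¹(T_X) + h⁰(∧²T_X) = 3 + 9 + 3 = 15`, `dim [H²(𝒪_X) ⊕ H⁰(∧²T_X)] = 6 =
rank(ob_{F′})` (Prop. 8.3.9), `dim ker(ob_{F′}) = 15 − 6 = 9 = h¹(T_X)`, and «`dim(K) > 9`» would give
`dim K + 6 > 15`. [cite: Markman2025SecantWeil, Corollary 8.3.12 (v2 p. 63 L17–43), Prop. 8.3.9 (p. 61 L76),
§8.3 (p. 58 L43)] -/
theorem cor8312_numbers (n : ℕ) (hn : 1 ≤ n) :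
    ((1 : ℚ) ≠ 0 ∧ (2 * (n : ℚ)) ≠ 0 ∧ (-( (n : ℚ) / 2)) * 2 = -(n : ℚ)) ∧
    (Nat.choose 3 2 + 3 * 3 + Nat.choose 3 2 = 15 ∧ Nat.choose 3 2 + Nat.choose 3 1 * Nat.choose 3 3 = 6 ∧
      15 - 6 = 9 ∧ 9 = 3 * 3 ∧ ∀ k : ℕ, 9 < k → 15 < k + 6) := by
  refine ⟨⟨one_ne_zero, ?_, by ring⟩, by decide, by decide, by norm_num, by norm_num, fun k hk => by omega⟩
  have : (0 : ℚ) < 2 * (n : ℚ) := by positivity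
  exact ne_of_gt this

end Squeeze

end ObstructionKernel

end Literature.AlgebraicGeometry.Markman2025
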